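import Mathlib

/-!
# Sketch (ideator 2, round 1) — crux `LatticeGapInUVUnitsC` (stmt-QuantumFields-16206)

First lemma of idea card `nested-shell-rho-mixing`: Hirschfeld–Gebelein–Rényi maximal correlation is
SUBMULTIPLICATIVE along a Markov triple of σ-algebras.  If conditional expectation onto `m₂` contracts
mean-zero `m₁`-observables by `ρ₁` in `L²`, conditional expectation onto `m₃` contracts mean-zero
`m₂`-observables by `ρ₂`, and the tower through `m₂` holds (`μ[f|m₃] = μ[μ[f|m₂]|m₃]` for `m₁`-measurable
`f` — the Markov / conditional-independence property of nested separating shells of Wilson's measure,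
cf. `WilsonBlockHeatBath.exists_local_condExp_version`), then conditional expectation onto `m₃` contracts
mean-zero `m₁`-observables by `ρ₁ ρ₂`.  Iterated along the chain of nested closed shells at physical spacing
`⌈Θ/a β⌉` around `supp A`, this turns a radius-uniform bound `ρ < 1` on the maximal correlation of consecutive
shells into `|Cov(A, τ_n B)| ≤ σ_A σ_B ρ^{⌊(n - r_A - r_B)/(D+1)⌋}`, i.e. the crux's conclusion with
`c₁ = log(1/ρ)/(2Θ)` (using `D · a β ≤ 2Θ` eventually, Disproof §4) and pair-dependent constants (Disproof §7).
-/

open MeasureTheory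

namespace Summit.QuantumFields.YangMills.Cruxes.LatticeGapInUVUnitsC.Ideator2

variable {Ω : Type*} {m₁ m₂ m₃ m0 : MeasurableSpace Ω} {μ : Measure[m0] Ω}

/-- **HGR submultiplicativity along a Markov triple** (squared-integral form, bounded observables). -/
theorem condExp_sq_le_of_tower [IsProbabilityMeasure μ]
    (hm₂ : m₂ ≤ m0) {ρ₁ ρ₂ : ℝ}
    (h12 : ∀ f : Ω → ℝ, StronglyMeasurable[m₁] f → Integrable f μ → (∃ M : ℝ, ∀ ω, |f ω| ≤ M) →
      ∫ ω, f ω ∂μ = 0 → ∫ ω, (μ[f|m₂]) ω ^ 2 ∂μ ≤ ρ₁ ^ 2 * ∫ ω, f ω ^ 2 ∂μ)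
    (h23 : ∀ g : Ω → ℝ, StronglyMeasurable[m₂] g → Integrable g μ →
      ∫ ω, g ω ∂μ = 0 → ∫ ω, (μ[g|m₃]) ω ^ 2 ∂μ ≤ ρ₂ ^ 2 * ∫ ω, g ω ^ 2 ∂μ)
    (htower : ∀ f : Ω → ℝ, StronglyMeasurable[m₁] f → Integrable f μ →
      μ[f|m₃] =ᵐ[μ] μ[μ[f|m₂]|m₃])
    (f : Ω → ℝ) (hf : StronglyMeasurable[m₁] f) (hfi : Integrable f μ) (hb : ∃ M : ℝ, ∀ ω, |f ω| ≤ M)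
    (h0 : ∫ ω, f ω ∂μ = 0) :
    ∫ ω, (μ[f|m₃]) ω ^ 2 ∂μ ≤ (ρ₁ * ρ₂) ^ 2 * ∫ ω, f ω ^ 2 ∂μ := by
  have hg : StronglyMeasurable[m₂] (μ[f|m₂]) := stronglyMeasurable_condExp
  have hgi : Integrable (μ[f|m₂]) μ := integrable_condExp
  have hg0 : ∫ ω, (μ[f|m₂]) ω ∂μ = 0 := by rw [integral_condExp hm₂]; exact h0
  have h1 := h23 (μ[f|m₂]) hg hgi hg0
  have h2 := h12 f hf hfi hb h0
  have heq : ∫ ω, (μ[f|m₃]) ω ^ 2 ∂μ = ∫ ω, (μ[μ[f|m₂]|m₃]) ω ^ 2 ∂μ := by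
    refine integral_congr_ae ?_
    filter_upwards [htower f hf hfi] with ω hω
    rw [hω]
  have hρ₂ : 0 ≤ ρ₂ ^ 2 := sq_nonneg _
  rw [heq]
  calc ∫ ω, (μ[μ[f|m₂]|m₃]) ω ^ 2 ∂μ ≤ ρ₂ ^ 2 * ∫ ω, (μ[f|m₂]) ω ^ 2 ∂μ := h1
    _ ≤ ρ₂ ^ 2 * (ρ₁ ^ 2 * ∫ ω, f ω ^ 2 ∂μ) := mul_le_mul_of_nonneg_left h2 hρ₂
    _ = (ρ₁ * ρ₂) ^ 2 * ∫ ω, f ω ^ 2 ∂μ := by ring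

/-- **Iteration** along a chain `m₀ → m₁ → … → m_k`: the contraction factors multiply (plain induction on the
list of shells; stated for a uniform factor `ρ`). -/
theorem pow_contraction (ρ : ℝ) (V : ℕ → ℝ)
    (hstep : ∀ j, V (j + 1) ≤ ρ ^ 2 * V j) : ∀ k, V k ≤ (ρ ^ 2) ^ k * V 0 := by
  intro k
  induction k with
  | zero => simp
  | succ k ih =>
    calc V (k + 1) ≤ ρ ^ 2 * V k := hstep k
      _ ≤ ρ ^ 2 * ((ρ ^ 2) ^ k * V 0) := mul_le_mul_of_nonneg_left ih (sq_nonneg _)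
      _ = (ρ ^ 2) ^ (k + 1) * V 0 := by ring

end Summit.QuantumFields.YangMills.Cruxes.LatticeGapInUVUnitsC.Ideator2
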